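import Mathlib.Geometry.Manifold.LocalDiffeomorph
import Mathlib.Geometry.Manifold.MFDeriv.Basic
import Mathlib.Geometry.Manifold.MFDeriv.SpecificFunctions
import Mathlib.Geometry.Manifold.Instances.Real
import Mathlib.Analysis.InnerProductSpace.PiL2
import Mathlib.Analysis.Complex.Basic
import Summits.SmoothPoincare4.SmoothPoincare4.Theorems.SymplecticOrigamiGromovRecognitionRelEndWedgeCoordinateDerivNeZero

/-!
# The wedge coordinate `T_V` has nowhere vanishing differential
(registered helper `helper_wedgeCoordinateDerivNeZeroV` of line `cross-cap-laurent`, crux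
`GromovRecognitionRelEnd`, item stmt-SmoothPoincare4-11009)

This is the `V`-side mirror of `SymplecticOrigamiGromovRecognitionRelEndWedgeCoordinateDerivNeZero`:
the roles of the two complex factors `(p 0, p 1)` and `(p 2, p 3)` of `ℝ⁴ = ℂ²` and of the charts
`ηH`, `ηV` are exchanged.

In the wedge cap `X` the sphere at infinity `V∞` is covered by the two cap charts
`ηV : D_V = {p 0² + p 1² < R₁⁻²} → X` and `ηC : D_C = {p 0² + p 1² < R₁⁻², p 2² + p 3² < R₁⁻²} → X`,
both `C^∞` local diffeomorphisms on their (open) polydiscs, and the wedge coordinate `T : X → ℂ`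
(`helper_wedgeCoordinateV`) is `C^∞` on the open set `U_V = ηV '' D_V ∪ ηC '' D_C` and reads
`T (ηV p) = p 0 + i p 1` on `D_V`, `T (ηC p) = p 0 + i p 1` on `D_C`.  This file proves that
`dT_y ≠ 0` at every `y ∈ U_V`.

Proof: write `y = η p` with `η ∈ {ηV, ηC}` and `p` in the corresponding open polydisc `D`.  On `D`
we have `T ∘ η = L`, where `L : ℝ⁴ →L[ℝ] ℂ`, `L p = p 0 + i p 1`, is a nonzero real continuous
linear map, so by the chain rule `dT_{η p} ∘ dη_p = d(T ∘ η)_p = L ≠ 0`, whence `dT_{η p} ≠ 0`;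
this is `WedgeCoordinateDerivNeZero.mfderiv_ne_zero_of_comp_eqOn` of the `H`-side file, reused.

Everything is proved; no definition, no named fact.

References: J. M. Lee, *Introduction to Smooth Manifolds*, 2nd ed. (2013), Prop. 3.6 (chain
rule) [LeeSmoothManifolds2013].
-/

-- the registered namespace `Summit.SmoothPoincare4.SmoothPoincare4.Theorems…` repeats a component
set_option linter.dupNamespace false

open scoped Manifold ContDiff Topology
open Set Function Filter

namespace Summit.SmoothPoincare4.SmoothPoincare4.Theorems.GromovRecognitionRelEnd.CrossCapLaurent

namespace WedgeCoordinateDerivNeZeroV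

/-- The first complex coordinate `p ↦ p 0 + i p 1` of `ℝ⁴ = ℂ²` is a real continuous linear map
`ℝ⁴ →L[ℝ] ℂ`. [folklore] -/
theorem exists_clm_coord01V : ∃ L : EuclideanSpace ℝ (Fin 4) →L[ℝ] ℂ,
    ∀ p : EuclideanSpace ℝ (Fin 4), L p = ⟨p 0, p 1⟩ :=
  ⟨Complex.equivRealProdCLM.symm.toContinuousLinearMap.comp
      ((PiLp.proj 2 (fun _ : Fin 4 => ℝ) 0).prod (PiLp.proj 2 (fun _ : Fin 4 => ℝ) 1)),
    fun p => by apply Complex.ext <;> simp⟩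

/-- The first complex coordinate `p ↦ p 0 + i p 1` of `ℝ⁴ = ℂ²` is a NONZERO real-linear map (it
sends `(1, 0, 0, 0)` to `1`). [folklore] -/
theorem clm_coord01V_ne_zero {L : EuclideanSpace ℝ (Fin 4) →L[ℝ] ℂ}
    (hL : ∀ p : EuclideanSpace ℝ (Fin 4), L p = ⟨p 0, p 1⟩) : L ≠ 0 := by
  intro h
  have h1 := congrArg
    (fun Φ : EuclideanSpace ℝ (Fin 4) →L[ℝ] ℂ => (Φ (WithLp.toLp 2 ![1, 0, 0, 0])).re) h
  simp [hL] at h1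

end WedgeCoordinateDerivNeZeroV

open WedgeCoordinateDerivNeZero WedgeCoordinateDerivNeZeroV in
/-- **Registered helper `helper_wedgeCoordinateDerivNeZeroV`** (line `cross-cap-laurent`,
signature verbatim; `V`-side mirror of `helper_wedgeCoordinateDerivNeZero`): the wedge coordinate
`T : X → ℂ`, `C^∞` on the open set `U_V = ηV '' D_V ∪ ηC '' D_C` and reading
`T (ηV p) = p 0 + i p 1` on `D_V`, `T (ηC p) = p 0 + i p 1` on `D_C` through the `C^∞` local
diffeomorphisms `ηV`, `ηC`, has nonzero differential `dT_y ≠ 0` at every `y ∈ U_V`.  See the file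
header for the (chain rule) proof. [folklore] -/
theorem helper_wedgeCoordinateDerivNeZeroV : ∀ (X : Type) [TopologicalSpace X] [T2Space X]
    [ChartedSpace (EuclideanSpace ℝ (Fin 4)) X] [IsManifold (𝓡 4) ∞ X] (R₁ : ℝ)
    (ηV ηC : EuclideanSpace ℝ (Fin 4) → X) (T : X → ℂ), 0 < R₁ →
    IsLocalDiffeomorphOn 𝓘(ℝ, EuclideanSpace ℝ (Fin 4)) (𝓡 4) ∞ ηV
      {p : EuclideanSpace ℝ (Fin 4) | p 0 ^ 2 + p 1 ^ 2 < R₁⁻¹ ^ 2} →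
    IsLocalDiffeomorphOn 𝓘(ℝ, EuclideanSpace ℝ (Fin 4)) (𝓡 4) ∞ ηC
      {p : EuclideanSpace ℝ (Fin 4) | p 0 ^ 2 + p 1 ^ 2 < R₁⁻¹ ^ 2 ∧ p 2 ^ 2 + p 3 ^ 2 < R₁⁻¹ ^ 2} →
    IsOpen (ηV '' {p : EuclideanSpace ℝ (Fin 4) | p 0 ^ 2 + p 1 ^ 2 < R₁⁻¹ ^ 2} ∪
      ηC '' {p : EuclideanSpace ℝ (Fin 4) | p 0 ^ 2 + p 1 ^ 2 < R₁⁻¹ ^ 2 ∧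
        p 2 ^ 2 + p 3 ^ 2 < R₁⁻¹ ^ 2}) →
    ContMDiffOn (𝓡 4) 𝓘(ℝ, ℂ) ∞ T (ηV '' {p : EuclideanSpace ℝ (Fin 4) | p 0 ^ 2 + p 1 ^ 2 < R₁⁻¹ ^ 2} ∪
      ηC '' {p : EuclideanSpace ℝ (Fin 4) | p 0 ^ 2 + p 1 ^ 2 < R₁⁻¹ ^ 2 ∧
        p 2 ^ 2 + p 3 ^ 2 < R₁⁻¹ ^ 2}) →
    (∀ p : EuclideanSpace ℝ (Fin 4), p 0 ^ 2 + p 1 ^ 2 < R₁⁻¹ ^ 2 → T (ηV p) = ⟨p 0, p 1⟩) →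
    (∀ p : EuclideanSpace ℝ (Fin 4), p 0 ^ 2 + p 1 ^ 2 < R₁⁻¹ ^ 2 → p 2 ^ 2 + p 3 ^ 2 < R₁⁻¹ ^ 2 →
      T (ηC p) = ⟨p 0, p 1⟩) →
    ∀ y ∈ (ηV '' {p : EuclideanSpace ℝ (Fin 4) | p 0 ^ 2 + p 1 ^ 2 < R₁⁻¹ ^ 2} ∪
      ηC '' {p : EuclideanSpace ℝ (Fin 4) | p 0 ^ 2 + p 1 ^ 2 < R₁⁻¹ ^ 2 ∧
        p 2 ^ 2 + p 3 ^ 2 < R₁⁻¹ ^ 2}), mfderiv (𝓡 4) 𝓘(ℝ, ℂ) T y ≠ 0 := by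
  intro X _ _ _ _ R₁ ηV ηC T _ hVloc hCloc hUo hTsm hTV hTC y hy
  -- the two coordinate polydiscs are open
  set DV : Set (EuclideanSpace ℝ (Fin 4)) :=
    {p : EuclideanSpace ℝ (Fin 4) | p 0 ^ 2 + p 1 ^ 2 < R₁⁻¹ ^ 2} with hDV
  set DC : Set (EuclideanSpace ℝ (Fin 4)) :=
    {p : EuclideanSpace ℝ (Fin 4) | p 0 ^ 2 + p 1 ^ 2 < R₁⁻¹ ^ 2 ∧ p 2 ^ 2 + p 3 ^ 2 < R₁⁻¹ ^ 2}
    with hDC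
  have hc : ∀ i : Fin 4, Continuous fun p : EuclideanSpace ℝ (Fin 4) => p i := fun i =>
    (continuous_apply i).comp (PiLp.continuous_ofLp 2 _)
  have hr1 : Continuous fun p : EuclideanSpace ℝ (Fin 4) => p 0 ^ 2 + p 1 ^ 2 :=
    ((hc 0).pow 2).add ((hc 1).pow 2)
  have hr2 : Continuous fun p : EuclideanSpace ℝ (Fin 4) => p 2 ^ 2 + p 3 ^ 2 :=
    ((hc 2).pow 2).add ((hc 3).pow 2)
  have hDVo : IsOpen DV := isOpen_lt hr1 continuous_const
  have hDCo : IsOpen DC := (isOpen_lt hr1 continuous_const).and (isOpen_lt hr2 continuous_const)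
  -- the first complex coordinate as a nonzero real continuous linear map `ℝ⁴ →L[ℝ] ℂ`
  obtain ⟨L, hL⟩ := exists_clm_coord01V
  have hL0 : L ≠ 0 := clm_coord01V_ne_zero hL
  -- `T` is differentiable at every point of the open set `U_V`
  have hTd : ∀ z ∈ ηV '' DV ∪ ηC '' DC, MDifferentiableAt (𝓡 4) 𝓘(ℝ, ℂ) T z := fun z hz =>
    (hTsm.contMDiffAt (hUo.mem_nhds hz)).mdifferentiableAt (by simp)
  rcases hy with ⟨p, hp, rfl⟩ | ⟨p, hp, rfl⟩
  · -- `y = ηV p`, `p ∈ D_V`: `T ∘ ηV = L` on `D_V`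
    exact mfderiv_ne_zero_of_comp_eqOn hDVo hp (hVloc ⟨p, hp⟩) (hTd _ (Or.inl ⟨p, hp, rfl⟩))
      (fun q hq => (hTV q hq).trans (hL q).symm) hL0
  · -- `y = ηC p`, `p ∈ D_C`: `T ∘ ηC = L` on `D_C`
    exact mfderiv_ne_zero_of_comp_eqOn hDCo hp (hCloc ⟨p, hp⟩) (hTd _ (Or.inr ⟨p, hp, rfl⟩))
      (fun q hq => (hTC q hq.1 hq.2).trans (hL q).symm) hL0

end Summit.SmoothPoincare4.SmoothPoincare4.Theorems.GromovRecognitionRelEnd.CrossCapLaurent
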